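import Mathlib
import HarnessLib
import Summits.HubbardSuperconductivity.HubbardSuperconductivity.Theorems.KLProgrammeKLRegimeEngineTowerBlockIncrLevOrientedKitF
import Summits.HubbardSuperconductivity.HubbardSuperconductivity.Theorems.KLProgrammeKLRegimeEngineTowerPartialIncrLevOrientedF

/-!
# Route `KLProgramme` — crux K3 ENGINE (stmt-HubbardSuperconductivity-20437 `KLRegimeEngineV17F2`), stub (b) v2, THE LEVELS PACKAGE (ℓ), located item
# «(ℓ)-READOUT-F» piece (RO-2), layer (c′): EVERY LEVELLED NORM OF A PARTIAL-BLOCK INCREMENT `𝒱_j − 𝒱_{dk}` IN KIT FORM, floor arrays concrete (`c = 9`)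
# (cell gate-hubbard-kl, seat hubbard-kl-k3c2-p3 g14; twin of k3c3-p2's `klLevNormOf_klTowerIncr_le_kit_orientedF9` (…TowerBlockIncrLevOrientedKitF §2) with the
#  slice `(Λ_{d(k+1)}, Λ_{dk}]` replaced by `(Λ_j, Λ_{dk}]`, `dk ≤ j`; at `j = d(k+1)` the partial increment IS `Δ_k`)

WHY.  E1's part 7 `towerReadout_le` reads the partial-block increment `𝒱_j − 𝒱_{dk}` of a read-out level `j ∈ [dk, d(k+1))` in the kit form
`inc ≤ towerFO + Σ towerS + tail`; the generic composition `klLevNormOf_le_kit_oriented_of_doorForm_at` (…KitGeneric) is stated for any `T`, and the door form on the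
partial increment is `doorSum_partialIncr_le_orientedF9` (…TowerPartialIncrLevOrientedF).  This file is the per-prescription kit bound — the statement of
`klLevNormOf_klTowerIncr_le_kit_orientedF9` verbatim with the partial slice in the Gram / row / column hypotheses (`hj : dk ≤ j`) and the partial increment as the
measured polynomial; input profile = the law's (`klTowerMeasLev … d k`, `klTowerMuLevF … d k` at `F̃_{dk−1}`), output family any `J′ ≥ dk`, every prescription `Ωe`:

* **`klLevNormOf_partialIncr_le_kit_orientedF9`**.
Compositions of landed theorems; nothing about the model is asserted beyond them; nothing asserts (ℓ), any stub, K3 or superconductivity.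
References: BGM 2006 §2.7 (2.71a), §2.8 (2.76)–(2.84), (2.88)–(2.90), (2.96)–(2.98), Lemma 2.5, App. A3–A4 [cite: BenfattoGiulianiMastropietro2006].
-/

noncomputable section

namespace Summit.HubbardSuperconductivity.HubbardSuperconductivity.Theorems.EngineV8

set_option linter.dupNamespace false -- summit = problem name (single-conjunct summit), D-0017

open Classical
open Real Finset Literature.MathematicalPhysics.QuantumLattice Literature.Probability.LatticeModels GrassmannAlgebra
open Literature.MathematicalPhysics.QuantumLattice.FermiRG Literature.MathematicalPhysics.QuantumLattice.FermiRG.BGM2006Routing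
open Summit.HubbardSuperconductivity.HubbardSuperconductivity.Theorems.KLProgrammeLegKernels
open Summit.HubbardSuperconductivity.HubbardSuperconductivity.Theorems.KLRegimeSplit
open Summit.HubbardSuperconductivity.HubbardSuperconductivity.Theorems.KLRegimeWick
open Summit.HubbardSuperconductivity.HubbardSuperconductivity.Theorems.TwoPointAssembly
open Summit.HubbardSuperconductivity.HubbardSuperconductivity.Theorems.DispersionFlow
open scoped Nat

variable {L M : ℕ} [NeZero L]

/-! ## Every levelled norm of the partial increment in kit form -/

section Born

variable [NeZero M]

/-- **THE ORIENTED LEVELLED NORMS OF A PARTIAL-BLOCK INCREMENT IN KIT FORM, PIN-CREDITED, FLOOR ARRAYS CONCRETE, EVERY PRESCRIPTION.**  `1 ≤ d`, `1 ≤ k`,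
`dk ≤ j`, `2 ≤ dk`, `dk ≤ J′`, `Z^K_{Λ_{dk}} ≠ 0`; binders as in `klLevNormOf_klTowerIncr_le_kit_orientedF9` with the slice `(Λ_j, Λ_{dk}]`.  Then
`klLevNormOf … J′ (2(q+1)) (𝒱_j − 𝒱_{dk}) Ωe ≤ ε^{2q+1}·(cr·cc^{2q+1}·(27^F·(((1/2)^{dk−1})^{lumps F}·S + T)) + cr·cc^{2q+1}·((e²)^{q+2}/2·towerFO D κ² NF (q+1)))`. -/
theorem klLevNormOf_partialIncr_le_kit_orientedF9 {β : ℝ} (hβ : 0 < β) (U μ : ℝ) (K : TrigPolyC4v) {d k j J' : ℕ} (hd : 1 ≤ d)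
    (hk : 1 ≤ k) (hj : d * k ≤ j) (hJ' : d * k ≤ J') (hdk : 2 ≤ d * k) (hZ : hubbardEffPartitionFnCT L M β U μ 0 K (klScale klE0 (d * k)) ≠ 0)
    {κ : ℝ} (hκ : 0 < κ)
    (hGB : IsGramBoundedR ((sectorSubMatrix L M β (bgmFatMultiplier L M klE0 β (nambuXiCT L μ K) (d * k - 1))).transpose *
      hubbardCovSliceCT L M β μ 0 K (klScale klE0 j) (klScale klE0 (d * k)) *
        sectorSubMatrix L M β (bgmFatMultiplier L M klE0 β (nambuXiCT L μ K) (d * k - 1))) κ)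
    {α : ℝ} (hα : 0 < α)
    (hrow : ∀ X, ∑ Y, ‖((sectorSubMatrix L M β (bgmFatMultiplier L M klE0 β (nambuXiCT L μ K) (d * k - 1))).transpose *
        hubbardCovSliceCT L M β μ 0 K (klScale klE0 j) (klScale klE0 (d * k)) *
          sectorSubMatrix L M β (bgmFatMultiplier L M klE0 β (nambuXiCT L μ K) (d * k - 1))) X Y‖ ≤ α)
    (hcol : ∀ Y, ∑ X, ‖((sectorSubMatrix L M β (bgmFatMultiplier L M klE0 β (nambuXiCT L μ K) (d * k - 1))).transpose *
        hubbardCovSliceCT L M β μ 0 K (klScale klE0 j) (klScale klE0 (d * k)) *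
          sectorSubMatrix L M β (bgmFatMultiplier L M klE0 β (nambuXiCT L μ K) (d * k - 1))) X Y‖ ≤ α)
    {ρ : ℝ} (hρ : 0 < ρ)
    {cr cc : ℝ} (hcr0 : 0 ≤ cr) (hcc0 : 0 ≤ cc)
    (hrow' : ∀ X'', ∑ X', ‖(sectorAnalysisMatrix L M β (klAnisoFamily L M β μ K klE0 J') *
        sectorSubMatrix L M β (bgmFatMultiplier L M klE0 β (nambuXiCT L μ K) (d * k - 1))) X'' X'‖ ≤ cr)
    (hcol' : ∀ X', ∑ X'', ‖(sectorAnalysisMatrix L M β (klAnisoFamily L M β μ K klE0 J') *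
        sectorSubMatrix L M β (bgmFatMultiplier L M klE0 β (nambuXiCT L μ K) (d * k - 1))) X'' X'‖ ≤ cc)
    {N₀ : ℕ} (hN₀ : 2 ≤ N₀)
    (q : ℕ) (Ωe : Fin (2 * q + 1 + 1) → Option (SectorLeg (sectorCount J')))
    {Nt : ℕ → ℝ} (hNt0 : ∀ m, 0 ≤ Nt m) (hNt00 : Nt 0 = 0)
    (hNtB : ∀ m, imagTimeWeight β M * klTowerMeasLev L M β U μ K d k (2 * m) 0 ≤ Nt m)
    {NF : ℕ → ℝ} (hNF : ∀ m c, levelCount Ωe ≤ c + 1 → c ≤ levelCount Ωe →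
      (27 : ℝ) ^ c * (imagTimeWeight β M *
        (if c = 0 then klTowerMeasLev L M β U μ K d k (2 * m) 0 else klTowerMeasLev L M β U μ K d k (2 * m) (c + 1))) ≤ NF m)
    {D : ℕ} (hD : Fintype.card (SpaceTimeIdx L M × SectorLeg (sectorCount (d * k - 1))) / 2 ≤ D)
    {τ ψ : ℝ} (hτ1 : (exp 3 * κ) ^ 2 ≤ τ) (hτ2 : (exp 2 * (κ + ρ)) ^ 2 ≤ τ) (hψ1 : κ⁻¹ ^ 2 ≤ ψ) (hψ2 : ρ⁻¹ ^ 2 ≤ ψ)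
    (hguard : exp 1 * (9 * α) / κ ^ 2 * towerV D τ Nt < 1) :
    klLevNormOf L M β μ K J' (2 * q + 1 + 1) (klEffectiveAction L M β U μ K klE0 j - klTowerInput L M β U μ K d k) Ωe ≤
      imagTimeWeight β M ^ (2 * q + 1) *
        (cr * cc ^ (2 * q + 1) * ((27 : ℝ) ^ levelCount Ωe *
            (((1 / 2 : ℝ) ^ (d * k - 1)) ^ lumps (levelCount Ωe) *
                ∑ n ∈ Icc 2 (N₀ - 1), exp 1 * (exp 1 * (9 * α) / κ ^ 2) ^ (n - 1) * ψ ^ (q + 1) *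
                  towerS D τ (fun m : ℕ => imagTimeWeight β M * klTowerMuLevF L M β U μ K d k m * klLevUnitF β M 0 m (d * k - 1) / 27) n (q + 1) +
              ψ ^ (q + 1) * (exp 1 * towerV D τ Nt * (exp 1 * (9 * α) / κ ^ 2 * towerV D τ Nt) ^ (N₀ - 1) /
                (1 - exp 1 * (9 * α) / κ ^ 2 * towerV D τ Nt)))) +
          cr * cc ^ (2 * q + 1) * (exp 2 ^ (q + 2) / 2 * towerFO D (κ ^ 2) NF (q + 1))) := by
  have hε : 0 ≤ imagTimeWeight β M := imagTimeWeight_nonneg hβ.le M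
  have h9 : (((9 : ℕ) : ℝ)) = 9 := by norm_num
  have h9α : α ≤ ((9 : ℕ) : ℝ) * α := by rw [h9]; linarith
  have hτ0 : 0 ≤ τ := le_trans (by positivity) hτ1
  -- the full-pin family of the re-keyed instance and its rows
  set B : ℕ → ℕ → ℝ := fun m c => if c = 0 then klTowerMeasLev L M β U μ K d k (2 * m) 0
    else klTowerMeasLev L M β U μ K d k (2 * m) (c + 1) with hB
  have hB0 : ∀ m c, 0 ≤ B m c := fun m c => by
    rw [hB]; dsimp only; split_ifs <;> exact klTowerMeasLev_nonneg hβ.le U μ K d k _ _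
  have hBz : ∀ m, B m 0 = klTowerMeasLev L M β U μ K d k (2 * m) 0 := fun m => by rw [hB]; exact if_pos rfl
  have hNtB' : ∀ m, imagTimeWeight β M * B m 0 ≤ Nt m := fun m => by rw [hBz]; exact hNtB m
  have hNF' : ∀ m c, levelCount Ωe ≤ c + 1 → c ≤ levelCount Ωe → (27 : ℝ) ^ c * (imagTimeWeight β M * B m c) ≤ NF m :=
    fun m c h1 h2 => hNF m c h1 h2
  -- the door guard from the kit guard
  have hnV : normV (SpaceTimeIdx L M × SectorLeg (sectorCount (d * k - 1))) κ ρ (fun m' => imagTimeWeight β M * B m' 0) ≤ towerV D τ Nt :=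
    (normV_mono hκ.le hρ.le hNtB').trans
      ((normV_le_towerV hκ.le hρ.le hNt0 hNt00 hD).trans (towerV_mono (by positivity) hτ2 hNt0 fun _ => le_rfl))
  have hθV : Real.exp 1 * α * normV (SpaceTimeIdx L M × SectorLeg (sectorCount (d * k - 1))) κ ρ
      (fun m' => imagTimeWeight β M * klTowerMeasLev L M β U μ K d k (2 * m') 0) / κ ^ 2 < 1 := by
    have hn0 : 0 ≤ normV (SpaceTimeIdx L M × SectorLeg (sectorCount (d * k - 1))) κ ρ (fun m' => imagTimeWeight β M * B m' 0) :=
      normV_nonneg hκ.le hρ.le fun m' => mul_nonneg hε (hB0 _ _)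
    have hV0 : 0 ≤ towerV D τ Nt := towerV_nonneg (D := D) hτ0 hNt0
    have hfun : (fun m' => imagTimeWeight β M * klTowerMeasLev L M β U μ K d k (2 * m') 0) =
        fun m' => imagTimeWeight β M * B m' 0 := funext fun m' => by rw [hBz]
    rw [hfun]
    calc Real.exp 1 * α * normV (SpaceTimeIdx L M × SectorLeg (sectorCount (d * k - 1))) κ ρ
          (fun m' => imagTimeWeight β M * B m' 0) / κ ^ 2
        = exp 1 / κ ^ 2 * (α * normV (SpaceTimeIdx L M × SectorLeg (sectorCount (d * k - 1))) κ ρ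
            (fun m' => imagTimeWeight β M * B m' 0)) := by ring
      _ ≤ exp 1 / κ ^ 2 * ((9 * α) * towerV D τ Nt) :=
          mul_le_mul_of_nonneg_left (mul_le_mul (by linarith) hnV hn0 (by positivity)) (by positivity)
      _ = exp 1 * (9 * α) / κ ^ 2 * towerV D τ Nt := by ring
      _ < 1 := hguard
  have hguard' : exp 1 * (((9 : ℕ) : ℝ) * α) / κ ^ 2 * towerV D τ Nt < 1 := by rw [h9]; exact hguard
  -- the generic kit composition on k3c2-p3's pin-credited door form
  have h := klLevNormOf_le_kit_oriented_of_doorForm_at (L := L) (M := M) hβ.le μ K (J' := J') (n₁ := d * k - 1) (by omega)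
    (klEffectiveAction L M β U μ K klE0 j - klTowerInput L M β U μ K d k) hκ hρ hα.le h9α hcr0 hcc0 hN₀ (B := B) hB0
    (Bm := fun m : ℕ => imagTimeWeight β M * klTowerMuLevF L M β U μ K d k m * klLevUnitF β M 0 m (d * k - 1) / 27)
    (fun m => towerBmF_nonneg hβ U μ K d k m) (towerBmF_zero β U μ K d k)
    (θ := (1 / 2 : ℝ) ^ (d * k - 1)) (by positivity) (pow_le_one₀ (by norm_num) (by norm_num))
    Ωe hNt0 hNt00 hNtB' hNF' hD hτ1 hτ2 hψ1 hψ2 hguard'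
    (fun p J hp τ'' w'' => doorSum_partialIncr_le_orientedF9 (L := L) (M := M) hβ U μ K hd hk hj hJ' hdk hZ hκ hGB hα hrow hcol hρ hcc0
      hrow' hcol' hN₀ hθV p J hp τ'' w'')
  rw [h9] at h
  exact h

end Born

end Summit.HubbardSuperconductivity.HubbardSuperconductivity.Theorems.EngineV8

end
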